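import Mathlib
import Literature.NumberTheory.LFunctions.Zhang2022.Section3Lemma34
import Literature.NumberTheory.LFunctions.Zhang2022.Section3Lemma35Holds
import Literature.NumberTheory.LFunctions.Zhang2022.Section3Lemma36Holds
import HarnessLib

/-!
# Zhang (2022) §2–§3: Proposition 2.1 DISCHARGED (`#Ψ₂ ≪ 𝔓𝓛⁻⁷³⁹` under (A))

Topic `Literature/NumberTheory/LFunctions/Zhang2022` (Landau–Siegel adjudication tree; verdict-neutral;
cell siegel-zhang, DAG node `Z22:Prop2.1`, inner node I01 of the cone of Theorem 1).
Y. Zhang, *Discrete mean estimates and the Landau–Siegel zero*, arXiv:2211.02515v1 (2022)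
[Zhang2022LandauSiegel] — **an unrefereed manuscript under adjudication; nothing here bears on its
Theorems 1–2 or on Landau–Siegel zeros.**

> §2 p. 6, **Proposition 2.1.** "Let `Ψ₂` be the complement of `Ψ₁` in `Ψ`. If (A) holds, then
> `Σ_{ψ∈Ψ₂} 1 ≪ 𝔓𝓛⁻⁷³⁹`." §3 p. 16: "Proposition 2.1 follows from Lemma 3.4, 3.5 and 3.6 immediately."

`Skeleton.prop21_holds : Skeleton.Prop21` — the skeleton's kernel-checked union bound
`Skeleton.prop21_of_lemmas` (`SkeletonPartOne`) applied to the three discharged leaves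
`Skeleton.lemma34_holds` (`Section3Lemma34`), `Skeleton.lemma35_holds` (`Section3Lemma35Holds`),
`Skeleton.lemma36_holds` (`Section3Lemma36Holds`). No new definition, no named fact; (A) enters only
through Lemmas 3.5–3.6 (Lemma 3.1).

## References

* Y. Zhang, arXiv:2211.02515v1 (2022), §2 Prop. 2.1 p. 6; §3 p. 16 (tex L863).
  [cite: Zhang2022LandauSiegel, §2 Prop. 2.1]
-/

noncomputable section

namespace Literature.NumberTheory.LFunctions.Zhang2022.Skeleton

/-- **Proposition 2.1 HOLDS** (`Z22:Prop2.1`; §3 p. 16: "Proposition 2.1 follows from Lemma 3.4, 3.5 and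
3.6 immediately"): there is `C` with `#Ψ₂ ≤ C𝔓𝓛⁻⁷³⁹` under (A) for all large `D` — the union bound
`prop21_of_lemmas` fed with `lemma34_holds`, `lemma35_holds`, `lemma36_holds`.
[cite: Zhang2022LandauSiegel, §2 Prop. 2.1; §3 p. 16] -/
theorem prop21_holds : Prop21 := prop21_of_lemmas lemma34_holds lemma35_holds lemma36_holds

end Literature.NumberTheory.LFunctions.Zhang2022.Skeleton

end
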